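import Mathlib
import HarnessLib
import Summits.NavierStokesRegularity.NavierStokesRegularity.Theorems.PoloidalWindowDoorPoloidalWindowRigidityTimeShearLimitPast
import Summits.NavierStokesRegularity.NavierStokesRegularity.Theorems.PoloidalWindowDoorPoloidalWindowRigidityTimeShearPast

/-!
# Route `PoloidalWindowDoor`, crux `PoloidalWindowRigidity` (K2, stmt-NavierStokesRegularity-19708), line «lrc-jet» v2 —
# (TV) WITH SLOWLY VARYING SLOPE IS EMPTY, no boundedness assumed

Cell ns-regularity-ideate, seat ns-poloidal-K2-p3 gen 4 (stub-worker under the K2 lead ns-poloidal-K2-p1 g4; file landed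
`--supports stmt-NavierStokesRegularity-19708` as a helper).

The zoom-out theorems for the stratum (TV) («time-dependent proportional shear», `∂₂v_b(s,·) = μ(s)∂_b v₂(s,·)` on every
slice) combine: the K2 lead's `…TimeShearPast.eq_zero_of_timeShear_limsup` (p522043: `limsup_{τ→−∞}|μ| = ∞ ⇒ v ≡ 0`)
removes the boundedness hypothesis of this seat's `…TimeShearLimitPast.eq_zero_of_timeShear_slowlyVarying` (p523508:
bounded + slowly varying ⇒ `v ≡ 0`):

* `eq_zero_of_timeShear_slowlyVarying'` / `nonflatLiouville_of_timeShear_slowlyVarying'` — **class + poloidal + all-slices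
  proportional shear whose slope is SLOWLY VARYING under dilations (`μ(cs₁) − μ(cs₂) → 0` as `c → +∞` for all `s₁, s₂ < 0`)
  ⇒ `v ≡ 0`.**

So inside `stub_tvLiminf` the zoom-out method leaves exactly the slopes whose dilations `μ(c·)` do NOT become constant
along `c → +∞` (e.g. log-periodic `μ = −2 + sin log(−τ)`); those are ns-poloidal-K2-p2 g3's M12 liminf run.

WHAT THIS IS NOT: not a claim about Navier–Stokes regularity, not `stub_tvLiminf`, not LRC″ — a corollary of two landed
asymptotic strata (bears_on LADDER-NS N0, rung N0-LocalTubeDoorPoloidal).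
-/

noncomputable section

-- the summit and its single sub-problem share the name (CONVENTIONS §1), as in every Theorems file
set_option linter.dupNamespace false

namespace Summit.NavierStokesRegularity.NavierStokesRegularity.Theorems.PoloidalWindowDoorPoloidalWindowRigidityTimeShearSlowlyVarying

open Set Function Filter Topology
open scoped RealInnerProductSpace InnerProductSpace
open Literature.Analysis Literature.Analysis.FluidPDE
open Summit.NavierStokesRegularity.NavierStokesRegularity.Theorems.PoloidalWindowDoorPoloidalWindowRigidityTimeShearLimitPast
open Summit.NavierStokesRegularity.NavierStokesRegularity.Theorems.PoloidalWindowDoorPoloidalWindowRigidityTimeShearPast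
open Summit.NavierStokesRegularity.NavierStokesRegularity.Theorems.PoloidalWindowDoorPoloidalWindowRigidityFlat

variable {C : ℝ} {v : ℝ → EuclideanSpace ℝ (Fin 3) → EuclideanSpace ℝ (Fin 3)}

/-- **(TV) WITH SLOWLY VARYING SLOPE IS EMPTY.**  A profile of the route's Type-I class, poloidal along `e₃`, every
slice of which is proportional-shear (`∂₂v_b(s,·) = μ(s)∂_b v₂(s,·)`, `b = 0,1`) with a slope slowly varying under
dilations — `μ(c s₁) − μ(c s₂) → 0` as `c → +∞` for all `s₁, s₂ < 0` — vanishes identically: if `limsup|μ| = ∞` by the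
lead's flat door at the hot spot, otherwise `μ` is bounded on a far-past tail and the constant-shear door applies. -/
theorem eq_zero_of_timeShear_slowlyVarying' (hrate : HasTypeITimeDecay C v)
    (hcont : ContinuousOn (uncurry v) (Iio (0 : ℝ) ×ˢ univ))
    (hmild : ∀ s t : ℝ, s < t → t < 0 → ∀ x,
      v t x = UnboundedOperators.heatExtension (v s) (t - s) x - oseenDuhamel 1 s v v t x)
    (hdiv : ∀ t < 0, VectorCalculus.IsDivFree (v t))
    (hpol : ∀ s < 0, ∀ y, ⟪curl (v s) y, EuclideanSpace.single 2 (1 : ℝ)⟫_ℝ = 0) {μ : ℝ → ℝ}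
    (hslope : ∀ s < 0, ∀ y, ∀ b : Fin 3, b ≠ 2 →
      fderiv ℝ (v s) y (EuclideanSpace.single 2 1) b = μ s * fderiv ℝ (v s) y (EuclideanSpace.single b 1) 2)
    (hslow : ∀ s₁ s₂ : ℝ, s₁ < 0 → s₂ < 0 → Tendsto (fun c : ℝ => μ (c * s₁) - μ (c * s₂)) atTop (𝓝 0)) :
    ∀ t < 0, ∀ x, v t x = 0 := by
  by_cases hμ : ∀ M T : ℝ, ∃ τ < T, M ≤ |μ τ|
  · exact eq_zero_of_timeShear_limsup hrate hcont hmild hdiv hpol hslope hμ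
  · push Not at hμ
    obtain ⟨M, T₀, hbd⟩ := hμ
    exact eq_zero_of_timeShear_slowlyVarying hrate hcont hmild hdiv hpol hslope (M := M) (T₀ := T₀)
      (fun τ hτ => (hbd τ hτ).le) hslow

/-- (TV) with slowly varying slope: not backward-singular. -/
theorem nonflatLiouville_of_timeShear_slowlyVarying' (hrate : HasTypeITimeDecay C v)
    (hcont : ContinuousOn (uncurry v) (Iio (0 : ℝ) ×ˢ univ))
    (hmild : ∀ s t : ℝ, s < t → t < 0 → ∀ x,
      v t x = UnboundedOperators.heatExtension (v s) (t - s) x - oseenDuhamel 1 s v v t x)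
    (hdiv : ∀ t < 0, VectorCalculus.IsDivFree (v t))
    (hpol : ∀ s < 0, ∀ y, ⟪curl (v s) y, EuclideanSpace.single 2 (1 : ℝ)⟫_ℝ = 0) {μ : ℝ → ℝ}
    (hslope : ∀ s < 0, ∀ y, ∀ b : Fin 3, b ≠ 2 →
      fderiv ℝ (v s) y (EuclideanSpace.single 2 1) b = μ s * fderiv ℝ (v s) y (EuclideanSpace.single b 1) 2)
    (hslow : ∀ s₁ s₂ : ℝ, s₁ < 0 → s₂ < 0 → Tendsto (fun c : ℝ => μ (c * s₁) - μ (c * s₂)) atTop (𝓝 0)) :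
    ¬ IsBackwardSingularPoint v 0 :=
  not_backwardSingular_of_zero (eq_zero_of_timeShear_slowlyVarying' hrate hcont hmild hdiv hpol hslope hslow)

end Summit.NavierStokesRegularity.NavierStokesRegularity.Theorems.PoloidalWindowDoorPoloidalWindowRigidityTimeShearSlowlyVarying

end
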